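import Summits.AtomisticToContinuum.Crystallization.Theorems.FrustratedLawDichotomyCoherentFloorHalo
import Literature.MathematicalPhysics.StatisticalMechanics.LennardJonesClusters

/-!
# FrustratedLawDichotomy · crux `AperiodicFrustratedLawGap` (stmt-AtomisticToContinuum-27623) — THE RADIALLY `hin`-FREE HALO DOOR (class H / Z)
(cell decomp-a2c, lens-5 g114; FINDING «TEMPLATE-COMPLETENESS» + KFILE amendment E, E1)

Companion of `…CoherentFloorComplete` (the class-A door without `hin`).  The halo door of record `…CoherentFloorHalo.certFloorHalo_le_two_mul_rootEnergy`
((233)) carries `hin : ∀ x ∈ a, ‖x‖ + τ ≤ Rc ∧ ⟪x, n⟫ + τ ≤ s`; its RADIAL conjunct together with coherence on the half-window excludes every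
perturbed full host half-lattice (the shell `Rc − 0.02 < r < Rc` is occupied).  Here:
* §1 window functionals on a GENERAL measurable window `W` without any tube-inclusion hypothesis:
  `∫_W f d(count⌊S) = Σ_{x ∈ a, atomOf x ∈ W} f (atomOf x)` and `Σ_{x∈a} f (atomOf x) ≤ ∫_W f` when `f (atomOf x) ≤ 0` off `W`;
* §2 the halo force column with `hin` DELETED entirely (the NASH balance is split template / non-template; non-template atoms are off the
  half-window because the half-window's atoms are template atoms; the two far columns `farCol`, `halfCol` are unchanged);
* §3 ★ `certFloorHalo_le_two_mul_rootEnergy'` / `…_of_nash'` = (233) with ONLY the PLANE conjunct kept: `hin : ∀ x ∈ a, ⟪x, n⟫ + τ ≤ s`.  A template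
  atom off the half-window is then below the plane, hence radially outside, `r > Rc ≥ 1`, `V_LJ ≤ 0`: booked twice (template energy, energy tail),
  both non-positively.  The plane conjunct must stay (a near template atom beyond the plane could have `V_LJ > 0`); levels sit in layer gaps.
Same columns, same certificate shape, same K-file format; cells take radially COMPLETE templates (amendment E, E2).

House conventions: SI units · italic scalars, bold vectors, sans-serif tensors · numbered formulae only when referenced · en-dash for ranges ·
References = cited works, numbered, alphabetical · no footnotes; Remarks at section ends · British spelling, -ise · Lennard-Jones hyphenated; NASH
capitalised as the Statement's notion · "folklore" tags standard bookkeeping; no new references are cited in this file.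
0 defs · 0 sorry · imports the tree's `…CoherentFloorHalo` only.
-/

noncomputable section

namespace Summit.AtomisticToContinuum.Crystallization.Theorems.FrustratedLawDichotomyCoherentFloorHaloComplete

open MeasureTheory Metric Set Filter RealInnerProductSpace
open scoped BigOperators Topology ENNReal
open Literature.MathematicalPhysics.StatisticalMechanics (lennardJones rootEnergy rootEnergy_def)
open Literature.Probability.Process (IsRootedHardCore count_restrict_singleton_ne_zero_iff)
open Summit.AtomisticToContinuum.Crystallization.Theorems.ChargedEnergyGapNegative (E3)
open Summit.AtomisticToContinuum.Crystallization.Theorems.FrustratedLawDichotomyCoherentWindow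
open Summit.AtomisticToContinuum.Crystallization.Theorems.FrustratedLawDichotomyCoherentOn
open Summit.AtomisticToContinuum.Crystallization.Theorems.FrustratedLawDichotomyFarForceColumn (sum_norm_force_le_sevenTenths
  sum_norm_force_le_sevenTenths_of_far_from_root)
open Summit.AtomisticToContinuum.Crystallization.Theorems.FrustratedLawDichotomyHalfSpaceCapSharp
  (sum_norm_force_le_of_separated_halfspace_sharp_sevenTenths sum_inv_pow_six_le_of_separated_halfspace_sharp_sevenTenths)
open Summit.AtomisticToContinuum.Crystallization.Theorems.FrustratedLawDichotomyTransportPriceTail (countable_of_separated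
  integrable_lennardJones_of_isRootedHardCore)
open Literature.Probability.Process.LocalConfig (finite_inter_of_separated)
open Summit.AtomisticToContinuum.Crystallization.Theorems.FrustratedLawDichotomyNashForceBalance (hasSum_force_of_nash)
open Summit.AtomisticToContinuum.Crystallization.Theorems.FrustratedLawDichotomyCoherentFloorAlgebra
open Summit.AtomisticToContinuum.Crystallization.Theorems.FrustratedLawDichotomyCoherentFloor
open Summit.AtomisticToContinuum.Crystallization.Theorems.FrustratedLawDichotomyCoherentFloorHalo

variable {S : Set E3} {δ τ : ℝ} {a : Finset E3} {W : Set E3}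

/-! ## §1. Window functionals on a general window WITHOUT tube inclusion -/

open scoped Classical in
/-- **Window = the template atoms lying in it** (no tube inclusion): `S ∩ W = atomOf '' {x ∈ a | atomOf x ∈ W}`. [folklore] -/
theorem inter_eq_image_filter_of_coherentOn (hS : ∀ p ∈ S, ∀ p' ∈ S, p ≠ p' → δ ≤ dist p p') (hτ : 2 * τ < δ)
    (hW : MeasurableSet W) (h : (Measure.count.restrict S : Measure E3) ∈ coherentOn a τ W) :
    S ∩ W = atomOf S τ '' ((a.filter fun x => atomOf S τ x ∈ W : Finset E3) : Set E3) := by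
  apply Set.Subset.antisymm
  · intro p hp
    obtain ⟨x, hx, hpx⟩ := inter_subset_image_atomOf_of_coherentOn hS hτ hW h hp
    refine ⟨x, ?_, hpx⟩
    rw [Finset.coe_filter]
    exact ⟨hx, by rw [hpx]; exact hp.2⟩
  · rintro _ ⟨x, hx, rfl⟩
    rw [Finset.coe_filter] at hx
    exact ⟨(atomOf_mem (nonempty_of_mem_coherentOn hW h hx.1)).2, hx.2⟩

open scoped Classical in
/-- The configuration restricted to the window is the counting measure of those template atoms (no tube inclusion). [folklore] -/
theorem restrict_eq_count_image_filter_of_coherentOn (hS : ∀ p ∈ S, ∀ p' ∈ S, p ≠ p' → δ ≤ dist p p') (hτ : 2 * τ < δ)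
    (hW : MeasurableSet W) (h : (Measure.count.restrict S : Measure E3) ∈ coherentOn a τ W) :
    (Measure.count.restrict S : Measure E3).restrict W =
      Measure.count.restrict ((((a.filter fun x => atomOf S τ x ∈ W).image (atomOf S τ) : Finset E3)) : Set E3) := by
  rw [Measure.restrict_restrict hW, Set.inter_comm, inter_eq_image_filter_of_coherentOn hS hτ hW h, Finset.coe_image]

open scoped Classical in
/-- ★ **WINDOW FUNCTIONALS WITHOUT TUBE INCLUSION**: `∫ z in W, f z ∂(count⌊S) = Σ_{x ∈ a, atomOf x ∈ W} f (atomOf x)`. [folklore] -/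
theorem setIntegral_eq_sum_filter_of_coherentOn (hS : ∀ p ∈ S, ∀ p' ∈ S, p ≠ p' → δ ≤ dist p p') (hτ : 2 * τ < δ)
    (hW : MeasurableSet W) (h : (Measure.count.restrict S : Measure E3) ∈ coherentOn a τ W)
    (ha : ∀ x ∈ a, ∀ x' ∈ a, x ≠ x' → 2 * τ < dist x x') (f : E3 → ℝ) :
    ∫ z in W, f z ∂(Measure.count.restrict S : Measure E3) = ∑ x ∈ a.filter (fun x => atomOf S τ x ∈ W), f (atomOf S τ x) := by
  have hne : ∀ x ∈ a, (closedBall x τ ∩ S).Nonempty := fun x hx => nonempty_of_mem_coherentOn hW h hx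
  rw [restrict_eq_count_image_filter_of_coherentOn hS hτ hW h,
    Literature.MathematicalPhysics.StatisticalMechanics.integral_count_restrict_coe_finset,
    Finset.sum_image fun x hx x' hx' hxx' =>
      injOn_atomOf ha hne (Finset.mem_of_mem_filter x hx) (Finset.mem_of_mem_filter x' hx') hxx']

/-- ★ **THE TEMPLATE SUM IS BELOW THE WINDOW FUNCTIONAL** whenever `f` is non-positive on the template atoms OFF the window. [folklore] -/
theorem sum_atomOf_le_setIntegral_of_coherentOn (hS : ∀ p ∈ S, ∀ p' ∈ S, p ≠ p' → δ ≤ dist p p') (hτ : 2 * τ < δ)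
    (hW : MeasurableSet W) (h : (Measure.count.restrict S : Measure E3) ∈ coherentOn a τ W)
    (ha : ∀ x ∈ a, ∀ x' ∈ a, x ≠ x' → 2 * τ < dist x x') (f : E3 → ℝ)
    (hneg : ∀ x ∈ a, atomOf S τ x ∉ W → f (atomOf S τ x) ≤ 0) :
    ∑ x ∈ a, f (atomOf S τ x) ≤ ∫ z in W, f z ∂(Measure.count.restrict S : Measure E3) := by
  classical
  rw [setIntegral_eq_sum_filter_of_coherentOn hS hτ hW h ha f, ← Finset.sum_filter_add_sum_filter_not a (fun x => atomOf S τ x ∈ W)]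
  have h0 : ∑ x ∈ a.filter (fun x => ¬ atomOf S τ x ∈ W), f (atomOf S τ x) ≤ 0 :=
    Finset.sum_nonpos fun x hx => hneg x (Finset.mem_of_mem_filter x hx) (Finset.mem_filter.mp hx).2
  linarith

/-- ★ **The truncated template energy is below the half-window energy** when every template tube is BELOW THE PLANE (radially anything goes):
a template atom off `haloWindow n s Rc` is then outside `B̄(0,Rc)`, `Rc ≥ 1`, so `V_LJ ≤ 0` there. [folklore] -/
theorem sum_lennardJones_atomOf_le_setIntegral_halo {n : E3} (hn : ‖n‖ = 1) {s Rc : ℝ}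
    (hS : ∀ p ∈ S, ∀ p' ∈ S, p ≠ p' → δ ≤ dist p p') (hτ : 2 * τ < δ)
    (h : (Measure.count.restrict S : Measure E3) ∈ coherentOn a τ (haloWindow n s Rc))
    (ha : ∀ x ∈ a, ∀ x' ∈ a, x ≠ x' → 2 * τ < dist x x') (hRc : 1 ≤ Rc) (hin : ∀ x ∈ a, ⟪x, n⟫ + τ ≤ s) :
    ∑ x ∈ a, lennardJones ‖atomOf S τ x‖ ≤ ∫ z in haloWindow n s Rc, lennardJones ‖z‖ ∂(Measure.count.restrict S : Measure E3) := by
  have hW := measurableSet_haloWindow n s Rc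
  refine sum_atomOf_le_setIntegral_of_coherentOn hS hτ hW h ha (fun z => lennardJones ‖z‖) fun x hx hxW => ?_
  have hm := atomOf_mem (nonempty_of_mem_coherentOn hW h hx)
  have hhalf : atomOf S τ x ∈ {z : E3 | ⟪z, n⟫ ≤ s} := closedBall_subset_halfSpace hn (hin x hx) hm.1
  have hball : atomOf S τ x ∉ closedBall (0 : E3) Rc := fun hb => hxW ⟨hb, hhalf⟩
  rw [mem_closedBall_zero_iff, not_le] at hball
  exact Literature.MathematicalPhysics.StatisticalMechanics.lennardJones_nonpos (hRc.trans hball.le)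

/-! ## §2. The halo force column WITHOUT `hin` -/

/-- ★ THE FORCE-BALANCE SPLIT, halo form, WITHOUT `hin`.  If the actual atom `q_x = atomOf S τ x` of `x ∈ a` (at least `7/20` inside the ball and
below the plane) is in force equilibrium, the force on it from the OTHER TEMPLATE ATOMS (wherever they are) is at most
`T0(Rc − (‖x‖ + τ)) + TH♯(s − (⟪x,n⟫ + τ))`: a non-template atom is off the half-window (whose atoms are template atoms), i.e. outside the ball or
beyond the plane. [folklore] -/
theorem norm_sum_template_force_le_halo' {S : Set E3} {τ Rc s : ℝ} {a : Finset E3} {n : E3} (hn : ‖n‖ = 1)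
    (hS : ∀ p ∈ S, ∀ p' ∈ S, p ≠ p' → (7 : ℝ) / 10 ≤ dist p p') (hτ : 2 * τ < 7 / 10)
    (hcoh : (Measure.count.restrict S : Measure E3) ∈ coherentOn a τ (haloWindow n s Rc))
    (ha : ∀ x ∈ a, ∀ x' ∈ a, x ≠ x' → 2 * τ < dist x x')
    {x : E3} (hx : x ∈ a) (hR : 7 / 20 ≤ Rc - (‖x‖ + τ)) (hH : 7 / 20 ≤ s - (⟪x, n⟫ + τ))
    (hbal : HasSum (fun q : {q : E3 // (Measure.count.restrict S : Measure E3) {q} ≠ 0 ∧ q ≠ atomOf S τ x} =>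
      ((dist (atomOf S τ x) (q : E3))⁻¹ ^ 8 - (dist (atomOf S τ x) (q : E3))⁻¹ ^ 14) • (atomOf S τ x - (q : E3))) 0) :
    ‖∑ x' ∈ a.erase x, ljBondForce (atomOf S τ x - atomOf S τ x')‖ ≤ farCol (Rc - (‖x‖ + τ)) + halfCol (s - (⟪x, n⟫ + τ)) := by
  classical
  have h7 : (0 : ℝ) < 7 / 10 := by norm_num
  have hW := measurableSet_haloWindow n s Rc
  have hne : ∀ z ∈ a, (closedBall z τ ∩ S).Nonempty := fun z hz => nonempty_of_mem_coherentOn hW hcoh hz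
  set p : E3 := atomOf S τ x with hp
  have hpS : p ∈ S := (atomOf_mem (hne x hx)).2
  have hpn : ‖p‖ ≤ ‖x‖ + τ := norm_atomOf_le (hne x hx)
  have hpin : ⟪p, n⟫ ≤ ⟪x, n⟫ + τ := by
    have h1 : ‖p - x‖ ≤ τ := norm_atomOf_sub_le (hne x hx)
    have h2 : ⟪p - x, n⟫ ≤ ‖p - x‖ := by
      have := abs_real_inner_le_norm (p - x) n
      rw [hn, mul_one] at this
      exact (le_abs_self _).trans this
    have h3 : ⟪p, n⟫ = ⟪x, n⟫ + ⟪p - x, n⟫ := by rw [← inner_add_left, add_sub_cancel]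
    linarith
  set T := {q : E3 // (Measure.count.restrict S : Measure E3) {q} ≠ 0 ∧ q ≠ p}
  set f : T → E3 := fun q => ((dist p (q : E3))⁻¹ ^ 8 - (dist p (q : E3))⁻¹ ^ 14) • (p - (q : E3)) with hf
  have hmemT : ∀ q : T, (q : E3) ∈ S ∧ (q : E3) ≠ p := fun q =>
    ⟨(count_restrict_singleton_ne_zero_iff S q).mp q.2.1, q.2.2⟩
  have hdistT : ∀ q : T, (7 : ℝ) / 10 ≤ dist (q : E3) p := fun q => hS _ (hmemT q).1 p hpS (hmemT q).2
  -- the norms are summable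
  have hnorm : Summable fun q : T => ‖f q‖ := by
    refine summable_of_sum_le (fun q => norm_nonneg _) (c := farCol (7 / 10)) fun u => ?_
    have hmap : ∑ q ∈ u, ‖f q‖ =
        ∑ q ∈ u.map (Function.Embedding.subtype _), ‖((dist p q)⁻¹ ^ 8 - (dist p q)⁻¹ ^ 14) • (p - q)‖ := by
      rw [Finset.sum_map]; rfl
    rw [hmap]
    unfold farCol
    refine sum_norm_force_le_sevenTenths _ p (by norm_num) (fun q hq q' hq' hqq' => ?_) (fun q hq => ?_)
    · obtain ⟨w, -, rfl⟩ := Finset.mem_map.mp hq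
      obtain ⟨w', -, rfl⟩ := Finset.mem_map.mp hq'
      exact hS _ (hmemT w).1 _ (hmemT w').1 hqq'
    · obtain ⟨w, -, rfl⟩ := Finset.mem_map.mp hq
      exact hdistT w
  -- the TEMPLATE part of `T`
  set tpl : Finset E3 := (a.erase x).image (atomOf S τ) with htpl
  have hnear : {q : T | (q : E3) ∈ (tpl : Set E3)}.Finite :=
    Finite.of_injOn (f := fun q : T => (q : E3)) (t := (tpl : Set E3)) (fun q hq => hq) Subtype.val_injective.injOn tpl.finite_toSet
  set sW : Finset T := hnear.toFinset with hsW
  have hsplit := hbal.summable.sum_add_tsum_compl (s := sW)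
  rw [hbal.tsum_eq] at hsplit
  have hsum_s : ∑ q ∈ sW, f q = -∑' q : ↑((↑sW : Set T)ᶜ), f q := eq_neg_of_add_eq_zero_left hsplit
  -- complement points are not template atoms, hence off the half-window: outside the ball or beyond the plane
  have hout : ∀ q : ↑((↑sW : Set T)ᶜ), ((q : T) : E3) ∉ haloWindow n s Rc := fun q hqW => by
    have h1 : (q : T) ∉ (↑sW : Set T) := q.2
    have h2 : (q : T) ∉ hnear.toFinset := h1
    rw [Finite.mem_toFinset] at h2
    have h3 : ((q : T) : E3) ∉ (tpl : Set E3) := h2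
    obtain ⟨x', hx', hqx'⟩ := inter_subset_image_atomOf_of_coherentOn hS hτ hW hcoh ⟨(hmemT q).1, hqW⟩
    have hx'a : x' ∈ a := hx'
    by_cases hxx : x' = x
    · exact (hmemT q).2 (by rw [← hqx', hxx])
    · exact h3 (by rw [htpl, Finset.coe_image]; exact ⟨x', Finset.mem_coe.mpr (Finset.mem_erase.mpr ⟨hxx, hx'a⟩), hqx'⟩)
  have hnormc : Summable fun q : ↑((↑sW : Set T)ᶜ) => ‖f q‖ := hnorm.subtype _
  have htail : ∑' q : ↑((↑sW : Set T)ᶜ), ‖f q‖ ≤ farCol (Rc - (‖x‖ + τ)) + halfCol (s - (⟪x, n⟫ + τ)) := by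
    refine hnormc.tsum_le_of_sum_le fun u => ?_
    set emb : ↑((↑sW : Set T)ᶜ) ↪ E3 := ⟨fun q => ((q : T) : E3), fun q q' hqq' => Subtype.ext (Subtype.ext hqq')⟩ with hemb
    have hmap : ∑ q ∈ u, ‖f q‖ = ∑ q ∈ u.map emb, ‖((dist p q)⁻¹ ^ 8 - (dist p q)⁻¹ ^ 14) • (p - q)‖ := by
      rw [Finset.sum_map]; rfl
    rw [hmap]
    set v := u.map emb with hv
    have hvS : ∀ q ∈ v, q ∈ S ∧ q ∉ haloWindow n s Rc := fun q hq => by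
      obtain ⟨w, -, rfl⟩ := Finset.mem_map.mp hq
      exact ⟨(hmemT w).1, hout w⟩
    have hvsep : ∀ q ∈ v, ∀ q' ∈ v, q ≠ q' → (7 : ℝ) / 10 ≤ dist q q' := fun q hq q' hq' hqq' =>
      hS q (hvS q hq).1 q' (hvS q' hq').1 hqq'
    rw [← Finset.sum_filter_add_sum_filter_not v (fun q => q ∈ closedBall (0 : E3) Rc)]
    have hA : ∑ q ∈ v.filter (fun q => ¬ q ∈ closedBall (0 : E3) Rc), ‖((dist p q)⁻¹ ^ 8 - (dist p q)⁻¹ ^ 14) • (p - q)‖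
        ≤ farCol (Rc - (‖x‖ + τ)) := by
      unfold farCol
      refine sum_norm_force_le_sevenTenths_of_far_from_root _ p 0 (by rwa [dist_zero_right]) hR
        (fun q hq q' hq' hqq' => hvsep q (Finset.mem_filter.mp hq).1 q' (Finset.mem_filter.mp hq').1 hqq') (fun q hq => ?_)
      have h := (Finset.mem_filter.mp hq).2
      rw [mem_closedBall, not_le] at h
      exact h.le
    have hB : ∑ q ∈ v.filter (fun q => q ∈ closedBall (0 : E3) Rc), ‖((dist p q)⁻¹ ^ 8 - (dist p q)⁻¹ ^ 14) • (p - q)‖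
        ≤ halfCol (s - (⟪x, n⟫ + τ)) := by
      unfold halfCol
      refine sum_norm_force_le_of_separated_halfspace_sharp_sevenTenths _ p n hn hH
        (fun q hq q' hq' hqq' => hvsep q (Finset.mem_filter.mp hq).1 q' (Finset.mem_filter.mp hq').1 hqq') (fun q hq => ?_)
      obtain ⟨hqv, hqball⟩ := Finset.mem_filter.mp hq
      have hq2 : ¬ ⟪q, n⟫ ≤ s := fun h => (hvS q hqv).2 ⟨hqball, h⟩
      rw [inner_sub_left]
      linarith [not_le.mp hq2]
    linarith
  -- the template part of the balance is the template sum
  have hmapS : sW.map (Function.Embedding.subtype _) = tpl := by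
    ext q
    rw [Finset.mem_map]
    constructor
    · rintro ⟨w, hw, rfl⟩
      rw [hsW, Finite.mem_toFinset] at hw
      exact hw
    · intro hq
      have hq' := hq
      rw [htpl, Finset.mem_image] at hq'
      obtain ⟨x', hx', rfl⟩ := hq'
      have hx'a := Finset.mem_of_mem_erase hx'
      have hm := atomOf_mem (hne x' hx'a)
      have hneq : atomOf S τ x' ≠ p := fun h =>
        Finset.ne_of_mem_erase hx' ((injOn_atomOf ha hne) hx'a hx h)
      refine ⟨⟨atomOf S τ x', (count_restrict_singleton_ne_zero_iff S _).mpr hm.2, hneq⟩, ?_, rfl⟩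
      rw [hsW, Finite.mem_toFinset]
      exact hq
  have hwin : ∑ q ∈ sW, f q = ∑ x' ∈ a.erase x, ljBondForce (p - atomOf S τ x') :=
    calc ∑ q ∈ sW, f q = ∑ q ∈ sW.map (Function.Embedding.subtype _), ((dist p q)⁻¹ ^ 8 - (dist p q)⁻¹ ^ 14) • (p - q) := by
          rw [Finset.sum_map]; rfl
      _ = ∑ q ∈ (a.erase x).image (atomOf S τ), ((dist p q)⁻¹ ^ 8 - (dist p q)⁻¹ ^ 14) • (p - q) := by rw [hmapS]
      _ = ∑ x' ∈ a.erase x, ((dist p (atomOf S τ x'))⁻¹ ^ 8 - (dist p (atomOf S τ x'))⁻¹ ^ 14) • (p - atomOf S τ x') :=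
          Finset.sum_image fun x₁ h₁ x₂ h₂ h =>
            (injOn_atomOf ha hne) (Finset.mem_of_mem_erase h₁) (Finset.mem_of_mem_erase h₂) h
      _ = ∑ x' ∈ a.erase x, ljBondForce (p - atomOf S τ x') := Finset.sum_congr rfl fun x' _ => force_eq_ljBondForce _ _
  rw [← hwin, hsum_s, norm_neg]
  exact (norm_tsum_le_tsum_norm hnormc).trans htail

/-! ## §3. ★ The halo doors (233′): (233) verbatim, radial conjunct of `hin` deleted -/

/-- ★★★ **T2-H WITHOUT THE RADIAL `hin` — THE HALO CERTIFICATE FLOOR on a radially COMPLETE template.**  As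
`…CoherentFloorHalo.certFloorHalo_le_two_mul_rootEnergy` ((233)) with `hin` weakened to its PLANE conjunct `∀ x ∈ a, ⟪x, n⟫ + τ ≤ s`: template tubes may
stick out of the ball `B̄(0,Rc)` (never across the plane).  Same columns. [folklore] -/
theorem certFloorHalo_le_two_mul_rootEnergy' {S : Set E3} {τ Rc s : ℝ} {a I : Finset E3} {n : E3} (y : E3 → E3) (hn : ‖n‖ = 1) (hs : 1 ≤ s)
    (hS : ∀ p ∈ S, ∀ p' ∈ S, p ≠ p' → (7 : ℝ) / 10 ≤ dist p p') (h0S : (0 : E3) ∈ S)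
    (hτ0 : 0 ≤ τ) (hτ : 2 * τ < 7 / 10) (hRc : 1 ≤ Rc)
    (hcoh : (Measure.count.restrict S : Measure E3) ∈ coherentOn a τ (haloWindow n s Rc))
    (h0a : (0 : E3) ∈ a) (hIa : I ⊆ a) (ha : ∀ x ∈ a, ∀ x' ∈ a, x ≠ x' → 2 * τ < dist x x')
    (hin : ∀ x ∈ a, ⟪x, n⟫ + τ ≤ s) (hI : ∀ x ∈ I, 7 / 20 ≤ Rc - (‖x‖ + τ) ∧ 7 / 20 ≤ s - (⟪x, n⟫ + τ))
    (hbal : ∀ x ∈ I, HasSum (fun q : {q : E3 // (Measure.count.restrict S : Measure E3) {q} ≠ 0 ∧ q ≠ atomOf S τ x} =>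
      ((dist (atomOf S τ x) (q : E3))⁻¹ ^ 8 - (dist (atomOf S τ x) (q : E3))⁻¹ ^ 14) • (atomOf S τ x - (q : E3))) 0) :
    ∑ x ∈ a.erase 0, (phiT (‖x‖ ^ 2) - (τ ^ 2 * secondNeg ‖x‖ + energyRem ‖x‖ τ))
        - τ * ∑ z ∈ a.erase 0, ‖psiT (‖z‖ ^ 2) • z - certCoeff a I y z‖
        - ∑ x ∈ I, ⟪y x, ∑ x' ∈ a.erase x, ljBondForce (x - x')⟫
        - ∑ x ∈ I, ‖y x‖ * (farCol (Rc - (‖x‖ + τ)) + halfCol (s - (⟪x, n⟫ + τ)))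
        - 1 / 2 * ∑ x ∈ a, ∑ x' ∈ a.erase x, ‖mulExt I y x - mulExt I y x'‖ * forceRem ‖x - x'‖ (dispB τ x + dispB τ x')
        - tailCol Rc - halfEnergyCol s
      ≤ 2 * rootEnergy lennardJones (Measure.count.restrict S : Measure E3) := by
  classical
  have h7 : (0 : ℝ) < 7 / 10 := by norm_num
  have hW := measurableSet_haloWindow n s Rc
  have hne : ∀ z ∈ a, (closedBall z τ ∩ S).Nonempty := fun z hz => nonempty_of_mem_coherentOn hW hcoh hz
  -- the displacement field of the coherent window
  set d : E3 → E3 := fun z => atomOf S τ z - z with hd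
  have hq : ∀ z, z + d z = atomOf S τ z := fun z => by
    show z + (atomOf S τ z - z) = atomOf S τ z
    abel
  have hd0 : d 0 = 0 := by
    have h := atomOf_zero hS hτ h0S hτ0
    show atomOf S τ 0 - 0 = 0
    rw [h, sub_zero]
  have hdτ : ∀ z ∈ a, ‖d z‖ ≤ τ := fun z hz => norm_atomOf_sub_le (hne z hz)
  have hdisp : ∀ z ∈ a, ‖d z‖ ≤ dispB τ z := fun z hz => by
    unfold dispB
    split_ifs with h
    · rw [h, hd0, norm_zero]
    · exact hdτ z hz
  have hdispτ : ∀ z : E3, dispB τ z ≤ τ := fun z => by unfold dispB; split_ifs <;> linarith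
  -- (i) energy slots
  have heR : ∀ x ∈ a.erase 0,
      phiT (‖x‖ ^ 2) + psiT (‖x‖ ^ 2) * ⟪x, d x⟫ - (τ ^ 2 * secondNeg ‖x‖ + energyRem ‖x‖ τ) ≤ phiT (‖x + d x‖ ^ 2) := by
    intro x hx
    obtain ⟨hx0, hxa⟩ := Finset.mem_erase.mp hx
    have hxτ : τ < ‖x‖ := by
      have h := ha x hxa 0 h0a hx0
      rw [dist_zero_right] at h
      linarith
    exact phiT_taylor_ge x (d x) (hdτ x hxa) hxτ
  -- (iv) force-remainder slots
  have hfR : ∀ x ∈ I, ∀ x' ∈ a.erase x, ‖ljBondForce ((x + d x) - (x' + d x')) - ljBondForce (x - x') - ljBondForceLin (x - x') (d x - d x')‖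
      ≤ forceRem ‖x - x'‖ (dispB τ x + dispB τ x') := by
    intro x hx x' hx'
    obtain ⟨hx'x, hx'a⟩ := Finset.mem_erase.mp hx'
    have hxa := hIa hx
    have e : (x + d x) - (x' + d x') = (x - x') + (d x - d x') := by abel
    rw [e]
    refine norm_ljBondForce_taylor_le (x - x') (d x - d x') ((norm_sub_le _ _).trans (add_le_add (hdisp x hxa) (hdisp x' hx'a))) ?_
    have h3 := ha x hxa x' hx'a (Ne.symm hx'x)
    rw [dist_eq_norm] at h3
    linarith [hdispτ x, hdispτ x']
  -- (iv, far part) the force balance split, halo form — WITHOUT `hin`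
  have hC : ∀ x ∈ I, ‖∑ x' ∈ a.erase x, ljBondForce ((x + d x) - (x' + d x'))‖ ≤ farCol (Rc - (‖x‖ + τ)) + halfCol (s - (⟪x, n⟫ + τ)) := by
    intro x hx
    simp_rw [hq]
    exact norm_sum_template_force_le_halo' hn hS hτ hcoh ha (hIa hx) (hI x hx).1 (hI x hx).2 (hbal x hx)
  have hcore := windowSum_ge a I y d τ (fun x => τ ^ 2 * secondNeg ‖x‖ + energyRem ‖x‖ τ)
    (fun x x' => forceRem ‖x - x'‖ (dispB τ x + dispB τ x')) (fun x => farCol (Rc - (‖x‖ + τ)) + halfCol (s - (⟪x, n⟫ + τ)))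
    hIa hd0 hdτ heR hfR (fun x x' => by rw [norm_sub_rev, add_comm (dispB τ x)]) hC
  beta_reduce at hcore
  -- the energy side: template sum ≤ half-window energy (§1, plane conjunct only), beyond the plane ≥ −halfEnergyCol, outside the ball ≥ −tailCol
  have hint := integrable_lennardJones_of_isRootedHardCore h7 ⟨S, h0S, hS, rfl⟩
  have hwin : ∑ x ∈ a.erase 0, phiT (‖x + d x‖ ^ 2) ≤
      ∫ z in haloWindow n s Rc, lennardJones ‖z‖ ∂(Measure.count.restrict S : Measure E3) := by
    have h1 := sum_lennardJones_atomOf_le_setIntegral_halo hn hS hτ hcoh ha hRc hin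
    rw [← Finset.sum_erase_add a _ h0a, atomOf_zero hS hτ h0S hτ0, norm_zero] at h1
    have hV0 : lennardJones 0 = 0 := by unfold lennardJones; simp
    rw [hV0, add_zero] at h1
    calc ∑ x ∈ a.erase 0, phiT (‖x + d x‖ ^ 2) = ∑ x ∈ a.erase 0, lennardJones ‖atomOf S τ x‖ :=
          Finset.sum_congr rfl fun x _ => by rw [lennardJones_eq_phiT, hq]
      _ ≤ _ := h1
  have htail := (abs_le.mp (abs_setIntegral_compl_lennardJones_le hS hRc)).1
  have hhalf := setIntegral_ball_sdiff_lennardJones_ge (Rc := Rc) hn hs hS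
  have hball : ∫ z in closedBall (0 : E3) Rc, lennardJones ‖z‖ ∂(Measure.count.restrict S : Measure E3) =
      (∫ z in haloWindow n s Rc, lennardJones ‖z‖ ∂(Measure.count.restrict S : Measure E3)) +
        ∫ z in closedBall (0 : E3) Rc \ {z : E3 | ⟪z, n⟫ ≤ s}, lennardJones ‖z‖ ∂(Measure.count.restrict S : Measure E3) := by
    rw [haloWindow]
    exact (integral_inter_add_sdiff (measurableSet_halfSpace n s) hint.integrableOn).symm
  have hE : 2 * rootEnergy lennardJones (Measure.count.restrict S : Measure E3) =
      (∫ z in closedBall (0 : E3) Rc, lennardJones ‖z‖ ∂(Measure.count.restrict S : Measure E3)) +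
        ∫ z in (closedBall (0 : E3) Rc)ᶜ, lennardJones ‖z‖ ∂(Measure.count.restrict S : Measure E3) := by
    rw [rootEnergy_def, integral_add_compl measurableSet_closedBall hint]
    ring
  rw [hE, hball]
  linarith

/-- ★★★ **T2-H under the crux's own clauses, WITHOUT THE RADIAL `hin`**: rooted `7/10` hard core, NASH clause (e) verbatim, coherence on the halo
window with a radially complete template whose tubes lie below the plane, any `y`. [folklore] -/
theorem certFloorHalo_le_two_mul_rootEnergy_of_nash' {μ : Measure E3} {τ Rc s : ℝ} {a I : Finset E3} {n : E3} (y : E3 → E3)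
    (hn : ‖n‖ = 1) (hs : 1 ≤ s) (hμ : IsRootedHardCore (7 / 10) μ)
    (hNash : ∀ p : E3, μ {p} ≠ 0 → ∀ w : E3, (∀ q : E3, μ {q} ≠ 0 → q ≠ p → w ≠ q) →
      ∑' q : {q : E3 // μ {q} ≠ 0 ∧ q ≠ p}, lennardJones (dist p (q : E3)) ≤
        ∑' q : {q : E3 // μ {q} ≠ 0 ∧ q ≠ p}, lennardJones (dist w (q : E3)))
    (hτ0 : 0 ≤ τ) (hτ : 2 * τ < 7 / 10) (hRc : 1 ≤ Rc) (hcoh : μ ∈ coherentOn a τ (haloWindow n s Rc))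
    (h0a : (0 : E3) ∈ a) (hIa : I ⊆ a) (ha : ∀ x ∈ a, ∀ x' ∈ a, x ≠ x' → 2 * τ < dist x x')
    (hin : ∀ x ∈ a, ⟪x, n⟫ + τ ≤ s) (hI : ∀ x ∈ I, 7 / 20 ≤ Rc - (‖x‖ + τ) ∧ 7 / 20 ≤ s - (⟪x, n⟫ + τ)) :
    ∑ x ∈ a.erase 0, (phiT (‖x‖ ^ 2) - (τ ^ 2 * secondNeg ‖x‖ + energyRem ‖x‖ τ))
        - τ * ∑ z ∈ a.erase 0, ‖psiT (‖z‖ ^ 2) • z - certCoeff a I y z‖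
        - ∑ x ∈ I, ⟪y x, ∑ x' ∈ a.erase x, ljBondForce (x - x')⟫
        - ∑ x ∈ I, ‖y x‖ * (farCol (Rc - (‖x‖ + τ)) + halfCol (s - (⟪x, n⟫ + τ)))
        - 1 / 2 * ∑ x ∈ a, ∑ x' ∈ a.erase x, ‖mulExt I y x - mulExt I y x'‖ * forceRem ‖x - x'‖ (dispB τ x + dispB τ x')
        - tailCol Rc - halfEnergyCol s
      ≤ 2 * rootEnergy lennardJones μ := by
  obtain ⟨S, h0S, hS, rfl⟩ := hμ
  have hW := measurableSet_haloWindow n s Rc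
  have hne : ∀ z ∈ a, (closedBall z τ ∩ S).Nonempty := fun z hz => nonempty_of_mem_coherentOn hW hcoh hz
  refine certFloorHalo_le_two_mul_rootEnergy' y hn hs hS h0S hτ0 hτ hRc hcoh h0a hIa ha hin hI fun x hx => ?_
  have hp : (Measure.count.restrict S : Measure E3) {atomOf S τ x} ≠ 0 :=
    (count_restrict_singleton_ne_zero_iff S _).mpr (atomOf_mem (hne x (hIa hx))).2
  exact hasSum_force_of_nash (by norm_num : (0 : ℝ) < 7 / 10) ⟨S, h0S, hS, rfl⟩ hp (hNash _ hp)

end Summit.AtomisticToContinuum.Crystallization.Theorems.FrustratedLawDichotomyCoherentFloorHaloComplete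

end
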